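import Mathlib

/-!
# Pressure of a positive semidefinite transfer matrix: `det (1 + M^N) = ∏ (1 + μᵢ^N)` and
# `|log det (1 + M^N) / N − Σᵢ log max(μᵢ, 1)| ≤ (dim · log 2) / N`
(helpers for crux stmt-QuantumFields-9734, line `Sketch`, static route, stub `stub_heavyFrequencyGain`, Route B step B3:
the static defect slab and the free comparison are controlled by PRESSURES `p(M) = Σᵢ log max(μᵢ,1) = log ‖Γ(M)‖`; this file
gives the eigenvalue formula for `det (1 + M^N)` and the uniform rate at which `N⁻¹ log det (1 + M^N)` approaches `p(M)`.)
-/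

namespace Summit.QuantumFields.QCD.Cruxes.CriticalLineDiamagnetism.ChessboardCellGain

open Matrix
open scoped BigOperators ComplexOrder MatrixOrder ComplexConjugate

/-- **Eigenvalue formula.** For `M ⪰ 0` with eigenvalues `μᵢ`: `det (1 + M^N) = ∏ᵢ (1 + μᵢ^N)` (a real number `≥ 1`). -/
theorem det_one_add_pow_eq : ∀ {k : Type} [Fintype k] [DecidableEq k] (M : Matrix k k ℂ) (hM : M.PosSemidef) (N : ℕ),
    (1 + M ^ N).det = ∏ i, (((1 + hM.1.eigenvalues i ^ N : ℝ)) : ℂ) := by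
  intro k _ _ M hM N
  classical
  set U := hM.1.eigenvectorUnitary with hUdef
  set d : k → ℂ := RCLike.ofReal ∘ hM.1.eigenvalues with hd
  have hspec : M = Unitary.conjStarAlgAut ℂ (Matrix k k ℂ) U (diagonal d) := hM.1.spectral_theorem
  -- `1 + M^N` is the conjugate of `1 + (diagonal d)^N = diagonal (1 + d^N)`
  have hpow : 1 + M ^ N = Unitary.conjStarAlgAut ℂ (Matrix k k ℂ) U (diagonal fun i => 1 + d i ^ N) := by
    rw [hspec, ← map_pow, diagonal_pow, ← map_one (Unitary.conjStarAlgAut ℂ (Matrix k k ℂ) U), ← map_add]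
    congr 1
    ext i j
    by_cases hij : i = j
    · subst hij; simp
    · simp [hij]
  rw [hpow, Unitary.conjStarAlgAut_apply, det_mul, det_mul, det_diagonal]
  have hUU : (U : Matrix k k ℂ).det * (star (U : Matrix k k ℂ)).det = 1 := by
    rw [← det_mul, Unitary.mul_star_self_of_mem U.prop, det_one]
  calc (U : Matrix k k ℂ).det * (∏ i, (1 + d i ^ N)) * (star (U : Matrix k k ℂ)).det
        = ((U : Matrix k k ℂ).det * (star (U : Matrix k k ℂ)).det) * ∏ i, (1 + d i ^ N) := by ring
    _ = ∏ i, (1 + d i ^ N) := by rw [hUU, one_mul]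
    _ = ∏ i, (((1 + hM.1.eigenvalues i ^ N : ℝ)) : ℂ) := by
          refine Finset.prod_congr rfl fun i _ => ?_
          simp [hd]

/-- Elementary: for `0 ≤ μ` and `N ≥ 1`, `N·log max(μ,1) ≤ log (1 + μ^N) ≤ N·log max(μ,1) + log 2`. -/
theorem log_one_add_pow_bounds {μ : ℝ} (hμ : 0 ≤ μ) (N : ℕ) :
    (N : ℝ) * Real.log (max μ 1) ≤ Real.log (1 + μ ^ N) ∧
      Real.log (1 + μ ^ N) ≤ (N : ℝ) * Real.log (max μ 1) + Real.log 2 := by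
  have hpow0 : 0 ≤ μ ^ N := pow_nonneg hμ N
  have hm1 : 1 ≤ max μ 1 := le_max_right _ _
  have hm0 : 0 < max μ 1 := lt_of_lt_of_le zero_lt_one hm1
  have hlogm : (N : ℝ) * Real.log (max μ 1) = Real.log ((max μ 1) ^ N) := by rw [Real.log_pow]
  have hμle : μ ^ N ≤ (max μ 1) ^ N := pow_le_pow_left₀ hμ (le_max_left _ _) N
  have h1le : (1 : ℝ) ≤ (max μ 1) ^ N := one_le_pow₀ hm1
  constructor
  · -- lower bound: `max(μ,1)^N ≤ 1 + μ^N`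
    rw [hlogm]
    apply Real.log_le_log (pow_pos hm0 N)
    rcases le_total μ 1 with h | h
    · rw [max_eq_right h, one_pow]; linarith
    · rw [max_eq_left h]; linarith
  · -- upper bound: `1 + μ^N ≤ 2 · max(μ,1)^N`
    rw [hlogm, ← Real.log_mul (pow_ne_zero N hm0.ne') two_ne_zero]
    apply Real.log_le_log (by linarith)
    linarith

/-- **Pressure limit with a uniform rate.** For `M ⪰ 0` with eigenvalues `μᵢ` and `N ≥ 1`:
`|log det (1 + M^N) / N − Σᵢ log max(μᵢ, 1)| ≤ (#k · log 2) / N`. -/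
theorem pressureLimit : ∀ {k : Type} [Fintype k] [DecidableEq k] (M : Matrix k k ℂ) (hM : M.PosSemidef) (N : ℕ), 0 < N →
    |Real.log (((1 + M ^ N).det).re) / N - ∑ i, Real.log (max (hM.1.eigenvalues i) 1)| ≤
      (Fintype.card k : ℝ) * Real.log 2 / N := by
  intro k _ _ M hM N hN
  classical
  have hdet := det_one_add_pow_eq M hM N
  have hre : ((1 + M ^ N).det).re = ∏ i, (1 + hM.1.eigenvalues i ^ N) := by
    rw [hdet, ← Complex.ofReal_prod, Complex.ofReal_re]
  have hpos : ∀ i, 0 < 1 + hM.1.eigenvalues i ^ N := fun i =>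
    lt_of_lt_of_le zero_lt_one (le_add_of_nonneg_right (pow_nonneg (hM.eigenvalues_nonneg i) N))
  have hlog : Real.log (((1 + M ^ N).det).re) = ∑ i, Real.log (1 + hM.1.eigenvalues i ^ N) := by
    rw [hre, Real.log_prod]
    intro i _; exact (hpos i).ne'
  have hNpos : (0 : ℝ) < N := by exact_mod_cast hN
  -- sum the elementary two-sided bounds
  have hlow : (N : ℝ) * ∑ i, Real.log (max (hM.1.eigenvalues i) 1) ≤ ∑ i, Real.log (1 + hM.1.eigenvalues i ^ N) := by
    rw [Finset.mul_sum]
    exact Finset.sum_le_sum fun i _ => (log_one_add_pow_bounds (hM.eigenvalues_nonneg i) N).1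
  have hup : ∑ i, Real.log (1 + hM.1.eigenvalues i ^ N) ≤
      (N : ℝ) * ∑ i, Real.log (max (hM.1.eigenvalues i) 1) + (Fintype.card k : ℝ) * Real.log 2 := by
    calc ∑ i, Real.log (1 + hM.1.eigenvalues i ^ N)
          ≤ ∑ i, ((N : ℝ) * Real.log (max (hM.1.eigenvalues i) 1) + Real.log 2) :=
            Finset.sum_le_sum fun i _ => (log_one_add_pow_bounds (hM.eigenvalues_nonneg i) N).2
      _ = (N : ℝ) * ∑ i, Real.log (max (hM.1.eigenvalues i) 1) + (Fintype.card k : ℝ) * Real.log 2 := by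
            rw [Finset.sum_add_distrib, Finset.mul_sum, Finset.sum_const, nsmul_eq_mul, Finset.card_univ]
  rw [hlog, abs_le]
  constructor
  · -- lower
    have : ∑ i, Real.log (max (hM.1.eigenvalues i) 1) ≤ (∑ i, Real.log (1 + hM.1.eigenvalues i ^ N)) / N := by
      rw [le_div_iff₀ hNpos]; linarith
    have h2 : 0 ≤ (Fintype.card k : ℝ) * Real.log 2 / N :=
      div_nonneg (mul_nonneg (Nat.cast_nonneg _) (Real.log_nonneg one_le_two)) hNpos.le
    linarith
  · -- upper
    have : (∑ i, Real.log (1 + hM.1.eigenvalues i ^ N)) / N ≤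
        ∑ i, Real.log (max (hM.1.eigenvalues i) 1) + (Fintype.card k : ℝ) * Real.log 2 / N := by
      rw [div_le_iff₀ hNpos, add_mul, div_mul_cancel₀ _ hNpos.ne']
      linarith
    linarith

end Summit.QuantumFields.QCD.Cruxes.CriticalLineDiamagnetism.ChessboardCellGain
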